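import Literature.MathematicalPhysics.QuantumFieldTheory.Balaban1983to89.Beta.RemainderOriginTowerDelta2
import Literature.MathematicalPhysics.QuantumFieldTheory.Balaban1983to89.Beta.RemainderHasMajH1kTowerPlaquette
import Literature.MathematicalPhysics.QuantumFieldTheory.Balaban1983to89.B9Thm311LaplaceAkPiPositiveDiagonal

/-!
# T. Bałaban, *The variational problem and background fields in renormalization group method for lattice gauge theories*, Commun. Math. Phys. **102** (1985)
# 277–309 [Balaban1985Variational] (182) p. 307, (190) p. 308, read against [Balaban1985BackgroundPropagators] (3.35)–(3.37) p. 396, Thm 3.11 p. 416, (3.126)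
# p. 420, (3.132)–(3.138) pp. 422–423 and [Balaban1985Averaging] Prop. 2 (52)–(54) p. 26: **NODE D OF ROW (D4) AT THE ORIGIN WITH BAŁABAN's `Δ⁽²⁾(U)` BUILT IN,
# ON PRINT's SMALL-FIELD CLASS — «Y18» `Beta.RemainderOriginTowerDelta2.exists_ineq190_origin_tower_delta2` WITH ITS CONSUMER's DISPLAY ∕ WITNESSES DERIVED**
# (the regularity display of `Q_k(U)` with its onto-threshold, the level profile, the `U1`-memberships, unitarity, the contractive transporters, the
# positivity of `Δ_{a,k}(U)`, `Δ′_{a′,k}(U)` and `Δ̃_{a,k}(U)`, the surjectivity of `Q_k(U)`) — «Y12b»'s bookkeeping for «Y18» (this lineage gen 115, «Y21»)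

CITATION HEADER (lean-in-tree rule 2026-08-18).  Audit cell `pub-balaban`, BINDER row (D4) (`RemainderConst` leaves for Bałaban's split), OWNER lineage
`b2b-balaban-beta-an4`, gen 115.  Loci exactly as in «Y18» and «Y12a»∕«Y12b» (this lineage): [Balaban1985Variational] ([15]; held
`paper:balaban1985-cmp102-variational-background`) (129)–(131) pp. 297–298, (180) p. 306, (182) p. 307, (190) p. 308; [Balaban1985BackgroundPropagators] ([5];
`paper:balaban1985-cmp99-background-propagators`) (3.11) p. 392, (3.15) p. 393, (3.35)–(3.37) p. 396, Thm 3.1 (3.42) p. 397, Thm 3.3 p. 399, Thm 3.11 p. 416 (*«Under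
the assumptions of the Theorems 3.1–3.10 … the operators Δ′_a, G′, (Q′G′²Q′*)⁻¹, Δ_a, G are positive definite.»*), (3.122) p. 420, (3.126) p. 420, (3.130) p. 421,
(3.132)–(3.138) pp. 422–423; [Balaban1985Averaging] ([4]) Prop. 2 (52)–(54) p. 26, (42)–(43) pp. 23–24, (18) p. 21, (136)–(138) p. 39, (145) p. 39, (149) p. 40,
(155) p. 41; [Balaban1984PropagatorsII] ([3]) (2.51)–(2.52) p. 232, (2.54) p. 233, Lemma 2.1 (2.61) p. 234.  Composed BY NAME: «Y18»; «Y12a» §2 `letters_of_windows`;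
the NE9 cell's `B9Thm311LaplaceAkPositiveDiagonal.exists_laplaceAk_pos_diagonal_closed`, `B9Thm311SitePrimeFormCoerciveTowerCanonical.exists_strong_site_coercive_tower_diagonal`,
`B9Thm311LaplaceAkPiPositiveDiagonal.exists_laplaceAkPi_pos_diagonal_closed`, `B9Eq326OperatorTower.QkW_surjective`.  Nothing of print is asserted here.

WHY THIS FILE («Y21»).  «Y18» (NODE D at the origin with Bałaban's `Δ⁽²⁾(U)` built in) displays, under its `∀`, the (K81)+«Y13a» binder block: besides the
diagonal, the weights (`c₀ = η^d`), the period, the background `U` in print's three windows and the current window (3.36) `‖J‖ ≤ j₀`, geometry ∕ rates and the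
derived constants, ALSO the cell's MODEL letters — the regularity display `αU` of the level averages (`hα0`, `hα1`, the onto-threshold `hαL`, `hU1`, `hreg`,
`hAQ`), the level profile `εU` (`hεU`, `hUε`, `hLb`, `hεg`), `hUst`, `hUb`, the contractive transporters `hRlev`, the positivity witnesses `hpos′` ([5] Thm 3.1's
site operator), `hpos` (Thm 3.3's bond operator WITH the Hessian's curvature part), `hposπ` (`Δ̃_{a,k} = π†Δ_{a,k}π`, (3.130)) and the onto witness `hQ` of
`Q_k(U)`.  ON PRINT's CLASS every one of them is a tree theorem («Y12a» `letters_of_windows`; the three Thm-3.11 theorems of the NE9 cell, `∃ α₀` first;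
`QkW_surjective` from the onto-threshold) — «Y12b» composed them for the `Δ⁽²⁾`-displayed END; THIS FILE does the same for «Y18»:
**`exists_ineq190_origin_tower_delta2_plaquette`** — `∃ (α⋆, B, δ, A′, r₁, j₁, Λ)` FIRST; under the `∀` ONLY the diagonal `(n, η, c₀ = η^d, c₁)`, the weights,
the period, a `unitaryUnits`-valued `U` in the THREE-WINDOW class with `0 ≤ α ≤ α⋆` and the current window `‖J‖ ≤ j₀ ≤ j₁`, geometry, rates, the derived
constants at «Y18»'s closed forms with the two smallnesses in `j₀`; CONCLUSION `∃ (αU, hα1, hαL, hU1, hreg, hpos)` (derived) `∃ Δ⁽²⁾ G′ Inv′` with «Y18»'s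
two-sided relations and `∀ δ′, δ′∕8 ≤ ρ → Ineq190 S^{coarse}_m S^{fine}_m (H₀ + G̃Δ⁽²⁾H₀) (A₀ + B_G̃θ_Dc) δ′`, `H₀ = H₁,k(U)` at the derived display ∕ witness.
Mechanism («Y12b»'s, plus the Π-witness and the onto witness): «Y18» at `ϱ := 1∕L`; `A := min(α⋆_{Y18}, α₁, α₀^{bond}, α₀^{site}, α₀^{Π})`; [4] Prop. 2's window
`α_P = 2α⋆′`, `α⋆′ = min(min(1∕(6C₀), c₂′∕8), min(1∕(2·3200(d+1)²(d+4)L^{d+2}), A∕(4K+1)))`, `K = 256(d+1)(d+4)`; common smallness `α″ = α + 2Kα⋆′ ≤ A`;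
threshold `α⋆ := min(A∕2, α⋆′)`.

HONEST SCOPE.  [folklore] bookkeeping BY NAME; NO estimate of [5], [15], [3] or [4] is proved here.  What stays DISPLAYED is of PRINTED SHAPE: print's (3.35)
read GLOBALLY on the torus (bond `αη`, plaquette `αη²`, bond-gradient `αη²` — the fine-bond and gradient windows are NOT derived from the plaquette window:
non-contractible holonomies), the current window (3.36) `‖J‖ ≤ j₀` ([5] (3.11)'s `J` of the background; not derived from the windows here), the weight
choice `c₀ = η^d` and `ρ_w`, [4] Prop. 5's smallnesses `(α₀, β)` at the top, the Hilbert-structure letters, the two smallnesses `q, q_I < 1` in `j₀`.  A MODEL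
result on the one-domain tower `Ω_k = T_η` (ONE level `j = k`): NOT Bałaban's multiscale `{Ω_j}`∕`𝔅` setting, NOT `Δ⁽²⁾_π` (3.135), NOT (3.138), NOT (189), NOT
the `Data190` plumbing (the successor plugs THIS END into «Y19» §3 exactly as «Y20» plugs «Y18»).  Row (D4) class UNCHANGED (instance 0∕1; critical-path width
0 = NODE O; D4 DISCHARGE NO DATE); NOT B12 Thm 2, NOT BetaPertH, NOT continuum, NOT Clay.  HONEST DEPENDENCY (cell line): continuum YM on T⁴ ⇐ BetaPertH ∧ nine
spine estimates (0/9 proved); BetaPertH ⇐ (D1) ∧ (D4) ∧ CAP+tail; G-an2-4 gates asym, D1 and NE2/3/4.  NEW file; nothing modified; 0 `def`; standard axioms;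
no `sorry`; `maxHeartbeats 400000` on the one theorem (the binder block, as «Y18»).  Net new unproved facts: 0.
-/

noncomputable section

set_option autoImplicit false

open scoped BigOperators InnerProductSpace ComplexConjugate

namespace Literature.MathematicalPhysics.QuantumFieldTheory.Balaban1983to89.Beta.RemainderOriginTowerDelta2Plaquette

open B11SectG B11SupSize190 open B9Eq311L2Pairing (WL2) open B4Sect5Torus (TSite tdist) open B4Sect5Proof (latticeConst) open B5TorusCover (UT)
open B9Thm34Ext (toB6) open B9Thm37GlueTorus (torusGeom tdist1) open B9SectCLatticeCarrier (Bond bpos btgt unshift) open B9Eq319QprimeTorus (fineP blockCoord)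
open B7Prop1Explicit (U1 Wcx boxVec) open B7Prop2Explicit (unitaryUnits mem_unitaryUnits pdev C0 c2' C0_pos c2'_pos unitaryUnits_le_U1) open B7Prop3Flat (c3)
open B7Prop5GeneralLevels (thetaGen C3Gen) open B11Eq103H1Complex (SiteL2K BondL2K H1LatticeK covDerivL2K) open B9Eq310DeltaPrime (plaqHolU)
open B9Eq310HessianOperator (adTransportW) open B9Eq315QTorus (perCfg perCfg_apply cornerSite) open B9Eq315QTower (towerP UlevOf)
open B9Eq316TowerFlatIsOneStep (towerP_eq_fineP_pow siteCast) open B9Eq326OperatorTower (QkW laplaceAk G1k H1k QkW_surjective)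
open B9Eq324DeltaPrimeATower (laplacePrimeAk) open B9Eq3119DeltaPiTower (laplaceAkPi)
open B9Thm311LaplaceAkPositiveDiagonal (exists_laplaceAk_pos_diagonal_closed)
open B9Thm311SitePrimeFormCoerciveTowerCanonical (exists_strong_site_coercive_tower_diagonal)
open B9Thm311LaplaceAkPiPositiveDiagonal (exists_laplaceAkPi_pos_diagonal_closed)
open Beta.RemainderHasMajH1kTowerPlaquette (letters_of_windows) open Beta.RemainderOriginTowerDelta2 (exists_ineq190_origin_tower_delta2)

section Tower

variable {d : ℕ} (hd : 1 ≤ d) (L : ℕ) [NeZero L] (hL : 1 ≤ L) (hL3 : 3 ≤ L)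
  {𝔸 : Type*} [CStarAlgebra 𝔸] [Nontrivial 𝔸]
  {W : Type} [NormedAddCommGroup W] [InnerProductSpace ℂ W] [FiniteDimensional ℂ W] (φ : W ≃ₗ[ℂ] 𝔸)
  {Mφ Mφ' : ℝ} (hMφ : 0 ≤ Mφ) (hMφ' : 0 ≤ Mφ') (hφ : ∀ w, ‖φ w‖ ≤ Mφ * ‖w‖) (hφ' : ∀ X, ‖φ.symm X‖ ≤ Mφ' * ‖X‖)
  {a : ℝ} (ha : 0 < a) {a' : ℝ} (ha' : 0 < a')
  (τ : 𝔸 →ₗ[ℂ] ℂ) {Cτ : ℝ} (hτ : ∀ X, ‖τ X‖ ≤ Cτ * ‖X‖) (hCτ : 0 ≤ Cτ) {Mτ : ℝ} (hτm : ∀ X Y : 𝔸, ‖τ (X * Y)‖ ≤ Mτ * ‖X‖ * ‖Y‖) (hMτ : 0 ≤ Mτ)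
  {ρw : ℝ} (hρw : 0 ≤ ρw)
  (hτ₁ : ∀ X : 𝔸, τ (star X) = conj (τ X)) (hτ₂ : ∀ X Y : 𝔸, τ (X * Y) = τ (Y * X)) (hφτ : ∀ X Y : 𝔸, ⟪φ.symm X, φ.symm Y⟫_ℂ = τ (star X * Y))
  (AQ : ℝ)
  (hAQ16 : 16 * ((d : ℝ) + 1) * ((d : ℝ) + 4) * c2' d L ≤ AQ)
  {α₀ β : ℝ} (hα : 0 < α₀) (hα3 : C0 d * α₀ ≤ 1 / 3) (hα4 : 4 * α₀ ≤ c2' d L) (hβ : 0 < β)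
  (hsmall : Real.exp (4 * (800 * ((d : ℝ) + 1) ^ 2 * ((d : ℝ) + 4)) * α₀) * (1 + 8 * (131072 * ((d : ℝ) + 1) ^ 2) * β) ≤ 2)
  (hc₃ : 4 * β < c3 d L)
  (h145 : 8 * d * thetaGen d L α₀ * (L : ℝ)⁻¹ ^ 4 ≤ 1)
  (h155 : (2 * (L : ℝ) - 1) * (L : ℝ)⁻¹ ^ 2 + 2 * d * thetaGen d L α₀ * (L : ℝ)⁻¹ ^ 3
    + 1 / 8 * (1 + 2 * d * thetaGen d L α₀ * (L : ℝ)⁻¹ ^ 2 + 2 * d * C3Gen d L * β) * (L : ℝ)⁻¹ ^ 2 ≤ 1)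

set_option maxHeartbeats 400000 in
include hd hL hL3 hMφ hMφ' hφ hφ' ha ha' hτ hCτ hτm hMτ hρw hτ₁ hτ₂ hφτ hAQ16 hα hα3 hα4 hβ hsmall hc₃ h145 h155 in
/-- **NODE D OF ROW (D4) AT THE ORIGIN WITH BAŁABAN's `Δ⁽²⁾(U)` BUILT IN, ON PRINT's CLASS — «Y18» WITH THE DISPLAY ∕ WITNESSES DERIVED** (see the module
docstring): `∃ (α⋆, B, δ, A′, r₁, j₁, Λ)` first; under the `∀` only the diagonal, the weights, the period, a `unitaryUnits`-valued `U` in the three-window class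
with `0 ≤ α ≤ α⋆` and the current window `‖J‖ ≤ j₀ ≤ j₁`, geometry, rates, the derived constants with the two smallnesses in `j₀`; conclusion
`∃ (αU, hα1, hαL, hU1, hreg, hpos) Δ⁽²⁾ G′ Inv′` with «Y18»'s relations and `Ineq190 S^{coarse}_m S^{fine}_m (H₀ + G̃Δ⁽²⁾H₀) (A₀ + B_G̃θ_Dc) δ′`.
[cite: Balaban1985Variational, (182) p.307, (190) p.308, (129)–(131) pp.297–298, (180) p.306] [cite: Balaban1985BackgroundPropagators, (3.134)–(3.138) pp.422–423,
(3.126) p.420, (3.132)–(3.133) p.422, Thm 3.1 (3.42) p.397, Thm 3.11 p.416, (3.35)–(3.37) p.396, (3.130) p.421] [cite: Balaban1985Averaging, (136)–(138) p.39, (149) p.40,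
Prop. 2 (52)–(54) p.26, (145) p.39, (155) p.41] [cite: Balaban1984PropagatorsII, (2.51)–(2.52) p.232, Lemma 2.1 (2.61) p.234] -/
theorem exists_ineq190_origin_tower_delta2_plaquette :
    ∃ αs B δ A' r₁ j₁ Λ : ℝ, 0 < αs ∧ 0 ≤ B ∧ 0 < δ ∧ 0 ≤ A' ∧ 0 < r₁ ∧ 0 < j₁ ∧ 0 ≤ Λ ∧
      ∀ (n : ℕ) (η : ℝ) (_hηL : η * (L : ℝ) ^ (n + 1) = 1) (c₀ c₁ : ℝ) [Fact (0 < c₀)] [Fact (0 < c₁)]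
        (_hw : c₀ * ((L : ℝ) ^ (n + 1)) ^ d = c₁) (_hρ : |η| ^ d / c₀ ≤ ρw) (_hc₀η : c₀ = η ^ d) (m : Fin d → ℕ) [∀ i, NeZero (m i)] (_hm : ∀ i, 1 ≤ m i)
        (U : Bond d (towerP L m (n + 1)) → 𝔸ˣ) (_hUu : ∀ b, U b ∈ unitaryUnits 𝔸)
        (α : ℝ) (_hα : 0 ≤ α) (_hαle : α ≤ αs) (_hUη : ∀ b, ‖(U b : 𝔸) - 1‖ ≤ α * η)
        (_hpl : ∀ p : B9SectCLatticeCarrier.Plaq d (towerP L m (n + 1)), ‖(plaqHolU U p : 𝔸) - 1‖ ≤ α * η ^ 2)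
        (_hUgrad : ∀ (x : TSite d (towerP L m (n + 1))) (μ : Fin d), ‖(U (x, μ) : 𝔸) - U (unshift μ x, μ)‖ ≤ α * η ^ 2)
        (j₀ : ℝ) (_hJ : ∀ μ y, ‖B9Eq39Adjoint.J (fun μ => B9Eq33CovDerivVector.shiftEquiv μ) (fun μ y => U (y, μ)) η μ y‖ ≤ j₀) (_hj : j₀ ≤ j₁)
        (η₀ L₀ M₀ R : ℝ) (H : Prop)
        -- the rates and the (free) row-sum constant
        (ρ σ c : ℝ) (_hσ : 0 < σ) (_hρ0 : 0 ≤ ρ) (_hρ₁ : ρ + 5 * σ ≤ δ / d) (_hρI : ρ + 5 * σ ≤ r₁ / d) (_hc_def : c = B6.c0 1 σ ^ d)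
    -- the derived constants, bound to their closed forms (instantiate with `rfl`; `λ = λ₀·e^{σ r_D}·c`), and the TWO smallnesses in `λ₀`
    {q BG' θP qI BI' A₀ θD BGt : ℝ}
    (hq_def : q = B * ((Λ * j₀) * Real.exp (σ * d) * c) * Real.exp (δ / d * d) * c) (hq : q < 1) (hBG' : BG' = B * (1 - q)⁻¹)
    (hθP : θP = B * ((Λ * j₀) * Real.exp (σ * d) * c) * Real.exp (δ / d * d) * BG' * c *
      ((Mφ' * Real.exp (100 * d * (d + 1) * (L : ℝ) ^ d * AQ) * Mφ * ((2 * d : ℕ) : ℝ)) * Real.exp 1 * latticeConst d 1) *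
      Real.exp ((ρ + 4 * σ) * d) * ((Mφ' * Mφ * Real.exp (50 * (d + 1) * AQ)) * Real.exp 1 * latticeConst d 1) *
      Real.exp ((ρ + 4 * σ) * d))
    (hqI : qI = A' * θP * c * c) (hqI1 : qI < 1) (hBI' : BI' = A' * (1 - qI)⁻¹)
    (hA₀ : A₀ = B * ((Mφ' * Real.exp (100 * d * (d + 1) * (L : ℝ) ^ d * AQ) * Mφ * ((2 * d : ℕ) : ℝ)) * Real.exp 1 *
      latticeConst d 1) * Real.exp δ * A' * c)
    (hθD : θD = A₀ * ((Λ * j₀) * Real.exp (σ * d) * c) * Real.exp (ρ * d))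
    (hBGt : BGt = BG' + ((Mφ' * Mφ * Real.exp (50 * (d + 1) * AQ)) * Real.exp 1 * latticeConst d 1) *
      ((Mφ' * Real.exp (100 * d * (d + 1) * (L : ℝ) ^ d * AQ) * Mφ * ((2 * d : ℕ) : ℝ)) * Real.exp 1 * latticeConst d 1) *
      BI' * BG' * BG' * Real.exp ((ρ + 2 * σ) * d) * Real.exp ((ρ + 2 * σ) * d) * c * c),
    ∃ (αU : ℕ → ℝ) (hα1 : ∀ j, αU j ≤ 1 / 64) (hαL : ∀ j, 50 * (d + 1) * αU j * (L : ℝ) ^ d ≤ 1 / 2)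
      (hU1 : ∀ (j : ℕ) (x : B7Prop1Explicit.Site d) (k : Fin d), perCfg (towerP L m (j + 1)) (UlevOf L m (n + 1) U j) x k ∈ U1 𝔸)
      (hreg : ∀ (j : ℕ) (y : TSite d (towerP L m j)) (k : Fin d) (ρ' : Fin d → Fin L),
        ‖((Wcx L (perCfg (towerP L m (j + 1)) (UlevOf L m (n + 1) U j)) (cornerSite L y) k (boxVec L ρ') : 𝔸ˣ) : 𝔸) - 1‖ ≤ αU j)
      (hpos : ∀ x : BondL2K ℂ d (towerP L m (n + 1)) c₀ W, x ≠ 0 →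
        0 < RCLike.re ⟪x, laplaceAk L m n φ η U hL αU hα1 hU1 hreg τ (c₀ := c₀) (c₁ := c₁) a x⟫_ℂ),
    ∃ D2 : BondL2K ℂ d (towerP L m (n + 1)) c₀ W →ₗ[ℂ] BondL2K ℂ d (towerP L m (n + 1)) c₀ W,
    ∃ (G' : (Bond d (towerP L m (n + 1)) → W) →L[ℂ] (Bond d (towerP L m (n + 1)) → W))
      (Inv' : (Bond d m → W) →L[ℂ] (Bond d m → W)),
      -- `G′ = (Δ_{a,k}(U) − Δ⁽²⁾)⁻¹`, two-sided
      G' * (LinearMap.toContinuousLinearMap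
          ((WL2.linearEquiv ℂ ℂ (fun _ : Bond d (towerP L m (n + 1)) => c₀) :
              BondL2K ℂ d (towerP L m (n + 1)) c₀ W ≃ₗ[ℂ] (Bond d (towerP L m (n + 1)) → W)).toLinearMap ∘ₗ
            laplaceAk L m n φ η U hL αU hα1 hU1 hreg τ (c₀ := c₀) (c₁ := c₁) a ∘ₗ
            (WL2.linearEquiv ℂ ℂ (fun _ : Bond d (towerP L m (n + 1)) => c₀) :
              BondL2K ℂ d (towerP L m (n + 1)) c₀ W ≃ₗ[ℂ] (Bond d (towerP L m (n + 1)) → W)).symm.toLinearMap) -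
        LinearMap.toContinuousLinearMap
          ((WL2.linearEquiv ℂ ℂ (fun _ : Bond d (towerP L m (n + 1)) => c₀) :
              BondL2K ℂ d (towerP L m (n + 1)) c₀ W ≃ₗ[ℂ] (Bond d (towerP L m (n + 1)) → W)).toLinearMap ∘ₗ D2 ∘ₗ
            (WL2.linearEquiv ℂ ℂ (fun _ : Bond d (towerP L m (n + 1)) => c₀) :
              BondL2K ℂ d (towerP L m (n + 1)) c₀ W ≃ₗ[ℂ] (Bond d (towerP L m (n + 1)) → W)).symm.toLinearMap)) = 1 ∧
      (LinearMap.toContinuousLinearMap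
          ((WL2.linearEquiv ℂ ℂ (fun _ : Bond d (towerP L m (n + 1)) => c₀) :
              BondL2K ℂ d (towerP L m (n + 1)) c₀ W ≃ₗ[ℂ] (Bond d (towerP L m (n + 1)) → W)).toLinearMap ∘ₗ
            laplaceAk L m n φ η U hL αU hα1 hU1 hreg τ (c₀ := c₀) (c₁ := c₁) a ∘ₗ
            (WL2.linearEquiv ℂ ℂ (fun _ : Bond d (towerP L m (n + 1)) => c₀) :
              BondL2K ℂ d (towerP L m (n + 1)) c₀ W ≃ₗ[ℂ] (Bond d (towerP L m (n + 1)) → W)).symm.toLinearMap) -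
        LinearMap.toContinuousLinearMap
          ((WL2.linearEquiv ℂ ℂ (fun _ : Bond d (towerP L m (n + 1)) => c₀) :
              BondL2K ℂ d (towerP L m (n + 1)) c₀ W ≃ₗ[ℂ] (Bond d (towerP L m (n + 1)) → W)).toLinearMap ∘ₗ D2 ∘ₗ
            (WL2.linearEquiv ℂ ℂ (fun _ : Bond d (towerP L m (n + 1)) => c₀) :
              BondL2K ℂ d (towerP L m (n + 1)) c₀ W ≃ₗ[ℂ] (Bond d (towerP L m (n + 1)) → W)).symm.toLinearMap)) * G' = 1 ∧
      -- `Inv′ = (Q_kG′Q_k†)⁻¹`, two-sided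
      Inv' * ((LinearMap.toContinuousLinearMap
          ((WL2.linearEquiv ℂ ℂ (fun _ : Bond d m => c₁) : BondL2K ℂ d m c₁ W ≃ₗ[ℂ] (Bond d m → W)).toLinearMap ∘ₗ
            QkW L m n φ U hL αU hα1 hU1 hreg (c₀ := c₀) (c₁ := c₁) ∘ₗ
            (WL2.linearEquiv ℂ ℂ (fun _ : Bond d (towerP L m (n + 1)) => c₀) :
              BondL2K ℂ d (towerP L m (n + 1)) c₀ W ≃ₗ[ℂ] (Bond d (towerP L m (n + 1)) → W)).symm.toLinearMap)).comp
        (G'.comp (LinearMap.toContinuousLinearMap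
          ((WL2.linearEquiv ℂ ℂ (fun _ : Bond d (towerP L m (n + 1)) => c₀) :
              BondL2K ℂ d (towerP L m (n + 1)) c₀ W ≃ₗ[ℂ] (Bond d (towerP L m (n + 1)) → W)).toLinearMap ∘ₗ
            LinearMap.adjoint (QkW L m n φ U hL αU hα1 hU1 hreg (c₀ := c₀) (c₁ := c₁)) ∘ₗ
            (WL2.linearEquiv ℂ ℂ (fun _ : Bond d m => c₁) : BondL2K ℂ d m c₁ W ≃ₗ[ℂ] (Bond d m → W)).symm.toLinearMap)))) = 1 ∧
      ((LinearMap.toContinuousLinearMap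
          ((WL2.linearEquiv ℂ ℂ (fun _ : Bond d m => c₁) : BondL2K ℂ d m c₁ W ≃ₗ[ℂ] (Bond d m → W)).toLinearMap ∘ₗ
            QkW L m n φ U hL αU hα1 hU1 hreg (c₀ := c₀) (c₁ := c₁) ∘ₗ
            (WL2.linearEquiv ℂ ℂ (fun _ : Bond d (towerP L m (n + 1)) => c₀) :
              BondL2K ℂ d (towerP L m (n + 1)) c₀ W ≃ₗ[ℂ] (Bond d (towerP L m (n + 1)) → W)).symm.toLinearMap)).comp
        (G'.comp (LinearMap.toContinuousLinearMap
          ((WL2.linearEquiv ℂ ℂ (fun _ : Bond d (towerP L m (n + 1)) => c₀) :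
              BondL2K ℂ d (towerP L m (n + 1)) c₀ W ≃ₗ[ℂ] (Bond d (towerP L m (n + 1)) → W)).toLinearMap ∘ₗ
            LinearMap.adjoint (QkW L m n φ U hL αU hα1 hU1 hreg (c₀ := c₀) (c₁ := c₁)) ∘ₗ
            (WL2.linearEquiv ℂ ℂ (fun _ : Bond d m => c₁) : BondL2K ℂ d m c₁ W ≃ₗ[ℂ] (Bond d m → W)).symm.toLinearMap)))) * Inv' = 1 ∧
      -- the (190) letter of `H₀ + G̃Δ⁽²⁾H₀`, `H₀ = H₁,k(U)` by name, `G̃ = G′ − G′Q_k†·Inv′·Q_kG′`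
      ∀ δ' : ℝ, δ' / 8 ≤ ρ →
        Ineq190
          (supSize (toB6 (torusGeom m η₀ L₀ M₀) R H)
            (fun y => Finset.univ.filter fun c : Bond d m => bpos c = UT.toSite m y)
            (fun c => UT.ofSite m (bpos c)) : BlockNorm (toB6 (torusGeom m η₀ L₀ M₀) R H) (Bond d m → W))
          (supSize (toB6 (torusGeom m η₀ L₀ M₀) R H)
            (fun y => Finset.univ.filter fun b : Bond d (towerP L m (n + 1)) =>
              blockCoord (L ^ (n + 1)) m (siteCast (towerP_eq_fineP_pow L m (n + 1)) (bpos b)) = UT.toSite m y)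
            (fun b => UT.ofSite m (blockCoord (L ^ (n + 1)) m (siteCast (towerP_eq_fineP_pow L m (n + 1)) (bpos b)))) :
              BlockNorm (toB6 (torusGeom m η₀ L₀ M₀) R H) (Bond d (towerP L m (n + 1)) → W))
          ((((WL2.linearEquiv ℂ ℂ (fun _ : Bond d (towerP L m (n + 1)) => c₀) :
                  BondL2K ℂ d (towerP L m (n + 1)) c₀ W ≃ₗ[ℂ] (Bond d (towerP L m (n + 1)) → W)).toLinearMap ∘ₗ
              H1k L m n φ η U hL αU hα1 hU1 hreg τ (c₀ := c₀) (c₁ := c₁) hαL hpos ∘ₗ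
              (WL2.linearEquiv ℂ ℂ (fun _ : Bond d m => c₁) : BondL2K ℂ d m c₁ W ≃ₗ[ℂ] (Bond d m → W)).symm.toLinearMap).restrictScalars ℝ) +
            ((G'.restrictScalars ℝ : (Bond d (towerP L m (n + 1)) → W) →ₗ[ℝ] (Bond d (towerP L m (n + 1)) → W)) -
              ((G'.restrictScalars ℝ : (Bond d (towerP L m (n + 1)) → W) →ₗ[ℝ] (Bond d (towerP L m (n + 1)) → W)) ∘ₗ
                (((WL2.linearEquiv ℂ ℂ (fun _ : Bond d (towerP L m (n + 1)) => c₀) :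
                      BondL2K ℂ d (towerP L m (n + 1)) c₀ W ≃ₗ[ℂ] (Bond d (towerP L m (n + 1)) → W)).toLinearMap ∘ₗ
                  LinearMap.adjoint (QkW L m n φ U hL αU hα1 hU1 hreg (c₀ := c₀) (c₁ := c₁)) ∘ₗ
                  (WL2.linearEquiv ℂ ℂ (fun _ : Bond d m => c₁) : BondL2K ℂ d m c₁ W ≃ₗ[ℂ] (Bond d m → W)).symm.toLinearMap).restrictScalars ℝ)) ∘ₗ
              (Inv'.restrictScalars ℝ : (Bond d m → W) →ₗ[ℝ] (Bond d m → W)) ∘ₗ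
              ((((WL2.linearEquiv ℂ ℂ (fun _ : Bond d m => c₁) : BondL2K ℂ d m c₁ W ≃ₗ[ℂ] (Bond d m → W)).toLinearMap ∘ₗ
                  QkW L m n φ U hL αU hα1 hU1 hreg (c₀ := c₀) (c₁ := c₁) ∘ₗ
                  (WL2.linearEquiv ℂ ℂ (fun _ : Bond d (towerP L m (n + 1)) => c₀) :
                    BondL2K ℂ d (towerP L m (n + 1)) c₀ W ≃ₗ[ℂ] (Bond d (towerP L m (n + 1)) → W)).symm.toLinearMap).restrictScalars ℝ) ∘ₗ
                (G'.restrictScalars ℝ : (Bond d (towerP L m (n + 1)) → W) →ₗ[ℝ] (Bond d (towerP L m (n + 1)) → W)))) ∘ₗ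
            ((((WL2.linearEquiv ℂ ℂ (fun _ : Bond d (towerP L m (n + 1)) => c₀) :
                    BondL2K ℂ d (towerP L m (n + 1)) c₀ W ≃ₗ[ℂ] (Bond d (towerP L m (n + 1)) → W)).toLinearMap ∘ₗ D2 ∘ₗ
                (WL2.linearEquiv ℂ ℂ (fun _ : Bond d (towerP L m (n + 1)) => c₀) :
                  BondL2K ℂ d (towerP L m (n + 1)) c₀ W ≃ₗ[ℂ] (Bond d (towerP L m (n + 1)) → W)).symm.toLinearMap).restrictScalars ℝ) ∘ₗ
              (((WL2.linearEquiv ℂ ℂ (fun _ : Bond d (towerP L m (n + 1)) => c₀) :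
                    BondL2K ℂ d (towerP L m (n + 1)) c₀ W ≃ₗ[ℂ] (Bond d (towerP L m (n + 1)) → W)).toLinearMap ∘ₗ
                H1k L m n φ η U hL αU hα1 hU1 hreg τ (c₀ := c₀) (c₁ := c₁) hαL hpos ∘ₗ
                (WL2.linearEquiv ℂ ℂ (fun _ : Bond d m => c₁) : BondL2K ℂ d m c₁ W ≃ₗ[ℂ] (Bond d m → W)).symm.toLinearMap).restrictScalars ℝ)))
          (A₀ + BGt * θD * c) δ' := by
  have hL2 : 2 ≤ L := le_trans (by norm_num) hL3
  have hL1r : (1 : ℝ) ≤ L := by exact_mod_cast hL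
  have hL0 : (0 : ℝ) < L := lt_of_lt_of_le one_pos hL1r
  have hr0 : (0 : ℝ) ≤ 1 / (L : ℝ) := by positivity
  have hr1 : 1 / (L : ℝ) < 1 := by
    rw [div_lt_one hL0]; exact_mod_cast (lt_of_lt_of_le (by norm_num) hL3 : 1 < L)
  have hstar : ∀ X : 𝔸, ‖star X‖ ≤ ‖X‖ := fun X => (norm_star X).le
  obtain ⟨αs, B, δ, A', r₁, α₁, j₁, Λ, hαs, hB, hδ, hA', hr₁, hα₁, hj₁, hΛ, HY⟩ :=
    exists_ineq190_origin_tower_delta2 hd L hL hL3 φ hMφ hMφ' hφ hφ' hstar ha ha' hr0 hr1 τ hτ hCτ hτm hMτ hρw hτ₁ hτ₂ hφτ AQ hAQ16 hα hα3 hα4 hβ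
      hsmall hc₃ h145 h155
  -- [5] Thm 3.11 on the diagonal, `∃ α₀` first: the bond operator WITH curvature, the site operator, and `Δ̃_{a,k} = π†Δ_{a,k}π`
  obtain ⟨αB, hαB, HB⟩ := exists_laplaceAk_pos_diagonal_closed L hL φ hMφ hMφ' hφ hφ' ha hr0 hr1 τ hτ hCτ hρw
  obtain ⟨αS, γS, hαS, hγS, HS⟩ := exists_strong_site_coercive_tower_diagonal L φ (a' := a') hMφ hMφ' hφ hφ' ha' hr0 hr1
  obtain ⟨αpi, hαpi, Hpi⟩ := exists_laplaceAkPi_pos_diagonal_closed (d := d) L hL φ hMφ hMφ' hφ hφ' ha ha' hr0 hr1 τ hτ hCτ hρw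
  -- the constants: the profile slack `K`, the common threshold `A`, the onto-threshold size `P_L`, [4] Prop. 2's window `α_P = 2α⋆′`
  obtain ⟨K, hK0, hKdef⟩ : ∃ K : ℝ, 0 ≤ K ∧ K = 256 * ((d : ℝ) + 1) * ((d : ℝ) + 4) := ⟨_, by positivity, rfl⟩
  obtain ⟨A, hA0, hAdef⟩ : ∃ A : ℝ, 0 < A ∧ A = min (min (min αs α₁) (min αB αS)) αpi :=
    ⟨_, lt_min (lt_min (lt_min hαs hα₁) (lt_min hαB hαS)) hαpi, rfl⟩
  have hC0 : 0 < C0 d := C0_pos d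
  have hc2 : 0 < c2' d L := c2'_pos d L hL
  obtain ⟨PL, hPL0, hPLdef⟩ : ∃ PL : ℝ, 0 < PL ∧ PL = 3200 * ((d : ℝ) + 1) ^ 2 * ((d : ℝ) + 4) * (L : ℝ) ^ (d + 2) :=
    ⟨_, by positivity, rfl⟩
  obtain ⟨αt, hαt0, hαtdef⟩ : ∃ αt : ℝ, 0 < αt ∧
      αt = min (min (1 / (6 * C0 d)) (c2' d L / 8)) (min (1 / (2 * PL)) (A / (4 * K + 1))) :=
    ⟨_, lt_min (lt_min (by positivity) (by positivity)) (lt_min (by positivity) (by positivity)), rfl⟩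
  have hαt1 : αt ≤ 1 / (6 * C0 d) := by rw [hαtdef]; exact (min_le_left _ _).trans (min_le_left _ _)
  have hαt2 : αt ≤ c2' d L / 8 := by rw [hαtdef]; exact (min_le_left _ _).trans (min_le_right _ _)
  have hαt3 : αt ≤ 1 / (2 * PL) := by rw [hαtdef]; exact (min_le_right _ _).trans (min_le_left _ _)
  have hαt4 : αt ≤ A / (4 * K + 1) := by rw [hαtdef]; exact (min_le_right _ _).trans (min_le_right _ _)
  have hαP : 0 < 2 * αt := by positivity
  have hαP3 : C0 d * (2 * αt) ≤ 1 / 3 := by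
    have h1 : C0 d * αt ≤ C0 d * (1 / (6 * C0 d)) := mul_le_mul_of_nonneg_left hαt1 hC0.le
    have h2 : C0 d * (1 / (6 * C0 d)) = 1 / 6 := by field_simp
    linarith
  have hαP4 : 4 * (2 * αt) ≤ c2' d L := by linarith
  have hαPL : 3200 * ((d : ℝ) + 1) ^ 2 * ((d : ℝ) + 4) * (L : ℝ) ^ (d + 2) * (2 * αt) ≤ 1 := by
    rw [← hPLdef]
    have h1 : PL * (2 * αt) ≤ PL * (2 * (1 / (2 * PL))) := mul_le_mul_of_nonneg_left (by linarith) hPL0.le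
    have h2 : PL * (2 * (1 / (2 * PL))) = 1 := by field_simp
    linarith
  have hKαt : (4 * K + 1) * αt ≤ A := by
    have h := mul_le_mul_of_nonneg_left hαt4 (by positivity : (0 : ℝ) ≤ 4 * K + 1)
    rwa [mul_div_cancel₀ _ (by positivity : (4 * K + 1 : ℝ) ≠ 0)] at h
  refine ⟨min (A / 2) αt, B, δ, A', r₁, j₁, Λ, lt_min (by positivity) hαt0, hB, hδ, hA', hr₁, hj₁, hΛ, ?_⟩
  intro n η hηL c₀ c₁ _ _ hw hρ hc₀η m _ hm U hUu α hα' hαle hUη hpl hUgrad j₀ hJ hj η₀ L₀ M₀ R H ρ σ c hσ hρ0 hρ₁ hρI hc_def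
    q BG' θP qI BI' A₀ θD BGt hq_def hq hBG' hθP hqI hqI1 hBI' hA₀ hθD hBGt
  have hαA : α ≤ A / 2 := hαle.trans (min_le_left _ _)
  have hααt : α ≤ αt := hαle.trans (min_le_right _ _)
  have hαlt : α < 2 * αt := by linarith only [hααt, hαt0]
  have hηpos : 0 < η := by
    have : η = ((L : ℝ) ^ (n + 1))⁻¹ := (inv_eq_of_mul_eq_one_left hηL).symm
    rw [this]; positivity
  obtain ⟨αU, εU, hαU0, hα1, hαL, hU1, hreg, hAQs, hεU, hLε, hLb, hεg, hUst, hUb, hRlev, hRS⟩ :=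
    letters_of_windows L m n φ τ hτ₂ hφτ hL3 hUu hαP hαP3 hαP4 hαPL hηL hα' hαlt hUη hpl
  -- the common smallness `α″ = α + 2Kα⋆′ ≤ A`
  have hα''A : α + 2 * K * αt ≤ A := by linarith only [hαA, hKαt, hαt0.le, mul_nonneg hK0 hαt0.le]
  have hα''0 : 0 ≤ α + 2 * K * αt := by positivity
  have hAs : A ≤ αs := by rw [hAdef]; exact (min_le_left _ _).trans ((min_le_left _ _).trans (min_le_left _ _))
  have hA1 : A ≤ α₁ := by rw [hAdef]; exact (min_le_left _ _).trans ((min_le_left _ _).trans (min_le_right _ _))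
  have hAB : A ≤ αB := by rw [hAdef]; exact (min_le_left _ _).trans ((min_le_right _ _).trans (min_le_left _ _))
  have hAS : A ≤ αS := by rw [hAdef]; exact (min_le_left _ _).trans ((min_le_right _ _).trans (min_le_right _ _))
  have hApi : A ≤ αpi := by rw [hAdef]; exact min_le_right _ _
  have hα''s : α + 2 * K * αt ≤ αs := hα''A.trans hAs
  have hα''1 : α + 2 * K * αt ≤ α₁ := hα''A.trans hA1
  have hα''B : α + 2 * K * αt ≤ αB := hα''A.trans hAB
  have hα''S : α + 2 * K * αt ≤ αS := hα''A.trans hAS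
  have hα''pi : α + 2 * K * αt ≤ αpi := hα''A.trans hApi
  have hαle'' : α ≤ α + 2 * K * αt := le_add_of_nonneg_right (by positivity)
  have hUη'' : ∀ b, ‖(U b : 𝔸) - 1‖ ≤ (α + 2 * K * αt) * η := fun b =>
    (hUη b).trans (mul_le_mul_of_nonneg_right hαle'' hηpos.le)
  have hpl'' : ∀ p : B9SectCLatticeCarrier.Plaq d (towerP L m (n + 1)), ‖(plaqHolU U p : 𝔸) - 1‖ ≤ (α + 2 * K * αt) * η ^ 2 := fun p =>
    (hpl p).trans (mul_le_mul_of_nonneg_right hαle'' (sq_nonneg η))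
  have hUgrad'' : ∀ (x : TSite d (towerP L m (n + 1))) (μ : Fin d), ‖(U (x, μ) : 𝔸) - U (unshift μ x, μ)‖ ≤ (α + 2 * K * αt) * η ^ 2 :=
    fun x μ => (hUgrad x μ).trans (mul_le_mul_of_nonneg_right hαle'' (sq_nonneg η))
  have hK2 : α + 256 * ((d : ℝ) + 1) * ((d : ℝ) + 4) * (2 * αt) = α + 2 * K * αt := by rw [hKdef]; ring
  have hεg'' : ∀ j < n + 1, εU j ≤ (α + 2 * K * αt) * (1 / (L : ℝ)) ^ j := fun j hj => by
    have h := hεg j hj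
    rwa [hK2] at h
  have hAQ' : ∑ j ∈ Finset.range (n + 1), αU j ≤ AQ := hAQs.trans hAQ16
  -- the three positivity witnesses at `α″` and the onto witness
  have hpos : ∀ x : BondL2K ℂ d (towerP L m (n + 1)) c₀ W, x ≠ 0 →
      0 < RCLike.re ⟪x, laplaceAk L m n φ η U hL αU hα1 hU1 hreg τ (c₀ := c₀) (c₁ := c₁) a x⟫_ℂ := fun x hx =>
    HB n η hηL c₀ c₁ hw hρ m U αU hα1 hU1 hreg εU hεU hLε hα''0 hα''B hRS hUb hUη'' hpl'' hεg'' x hx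
  have hpos' : ∀ x : SiteL2K ℂ d (towerP L m (n + 1)) c₀ W, x ≠ 0 → 0 < RCLike.re ⟪x, laplacePrimeAk L m n φ η U a' (c₁ := c₁) x⟫_ℂ := by
    intro x hx
    have key := HS n η hηL c₀ c₁ hw m U hRS (α + 2 * K * αt) hα''0 hα''S hUb hUη'' εU hεU hεg'' hLε hLb x
    have hx2 : 0 < ‖x‖ ^ 2 := by positivity
    have hp : 0 < γS * (‖covDerivL2K ℂ c₀ ((η : ℂ))⁻¹ (adTransportW φ (fun _ : Bond d (towerP L m (n + 1)) => (1 : 𝔸ˣ))) x‖ ^ 2 + ‖x‖ ^ 2) :=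
      mul_pos hγS (add_pos_of_nonneg_of_pos (sq_nonneg _) hx2)
    exact hp.trans_le key
  have hposπ : ∀ x : BondL2K ℂ d (towerP L m (n + 1)) c₀ W, x ≠ 0 →
      0 < RCLike.re ⟪x, laplaceAkPi L m n φ τ η U a' hpos' hL αU hα1 hU1 hreg (c₁ := c₁) a x⟫_ℂ := fun x hx =>
    Hpi n η hηL c₀ c₁ hw hρ m U αU hα1 hU1 hreg εU hεU hLε hα''0 hα''pi hRS hUb hUη'' hpl'' hεg'' hLb hpos' x hx
  have hQ : Function.Surjective (QkW L m n φ U hL αU hα1 hU1 hreg (c₀ := c₀) (c₁ := c₁)) :=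
    QkW_surjective L m n φ U hL αU hα1 hU1 hreg (c₀ := c₀) (c₁ := c₁) hαL
  refine ⟨αU, hα1, hαL, hU1, hreg, hpos, ?_⟩
  exact HY n η hηL c₀ c₁ hw hρ m hm U αU hαU0 hα1 hαL hU1 hreg εU hεU hLε hLb (α + 2 * K * αt) hα''0 hα''1 hUst hUb hUη'' hpl'' hUgrad''
    hRlev hεg'' hAQ' hpos' hpos hc₀η j₀ hJ hj hposπ hQ hα''s η₀ L₀ M₀ R H ρ σ c hσ hρ0 hρ₁ hρI hc_def hq_def hq hBG' hθP hqI hqI1 hBI' hA₀ hθD hBGt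

end Tower

end Literature.MathematicalPhysics.QuantumFieldTheory.Balaban1983to89.Beta.RemainderOriginTowerDelta2Plaquette

end
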